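import Summits.QuantumAdvantage.AdviceFreeQNC0.LinearSelections
import Summits.QuantumAdvantage.QuantumAdvantage.Theorems.WalkFiniteStateRungEquidist
import HarnessLib

/-!
# (G♯) local engine — part 1/3 — §1 the double count of discordant corner flips, §2 two-step free-split strategies and the regime statements

VERBATIM split (for the 400-line rule) of planner qa-qnc0-p2 g24's checked skeleton `HOME/qa-qnc0-p2/line24/LocalEngine.lean`
(sha16 `7aa61edea42d6c70`, 1013 lines, farm rc 0 / 0 sorry / 0 warnings; authored AND proved by the planner seat; landed by
qn-prover-3 g15, ask P2-24b, `--supports stmt-QuantumAdvantage-23121` = rung (G♯) `OddPrimeWalk.TwoStepFreeRungFive`) into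
`WalkTwoStepLocalEngine{Core,Regimes,Glue}.lean` (+ `WalkTwoStepOddRow.lean`); only the file boundaries, the per-file preambles,
these header lines and one-line docstrings on the planner's undocumented auxiliary lemmas (lint) are new.
WHAT THIS IS: the PROVED glue of the three-regime plan (double count of discordant corner flips, pigeonhole on popular split
positions, flip invariance, `FarLocal → FarHeavy`, per-class composition, pinned parts and `SparsePinned → DensePinned → NearRegime`,
`twoStepFreeRungFive_of : FarLocal 5 → SparsePinned 5 → DensePinned 5 → <item 23121 signature>`), with the three regime lemmas
`FarLocal`, `SparsePinned`, `DensePinned` as OPEN `def … : Prop` (route-posited statements, not Literature facts; plans in their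
docstrings and in HOME/qa-qnc0-p2/ROUND-24.md §1ter).  WHAT THIS IS NOT: no proof of the three regime lemmas, hence no proof of
(G♯) yet; nothing about `LinSel`/R5; separation NOT moved.

The planner's module docstring of §1 follows.

# LocalEngine (planner qa-qnc0-p2 g24, ROUND-24 §1ter): the combinatorial core of the bad-edge engine, PROVED,
# and the typed stubs of the three-regime plan for (G♯) `WalkHardFTwoStepFree p`

§1 `sum_discordant_le` — the DOUBLE COUNT: for any win predicate `f` on a finite type, any family of involutions `φ_τ`
and any finite set `T` of moves, if every LOSER is discordant (f changes) under at most `D` moves of `T`, then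
`Σ_{τ ∈ T} #{u : f u ≠ f (φ_τ u)} ≤ 2·D·#{v : f v = false}`.  (Every discordant pair has exactly one losing endpoint.)
Read contrapositively: many bad edges at the far-observed times force many losers — `loss ≥ (Σ_τ bad_τ)/(2D)`.
-/


namespace Summit.QuantumAdvantage.AdviceFreeQNC0.LocalEngine

open Finset

/-- **Double count of discordant (bad) edges.**  `φ τ` involutions; a loser `v` (`f v = false`) is discordant under at most `D`
of the moves in `T`; then the total number of discordant (move, input) pairs over `T` is at most `2·D·#losers`. -/
theorem sum_discordant_le {α ι : Type*} [Fintype α] [DecidableEq α] [DecidableEq ι]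
    (f : α → Bool) (φ : ι → α → α) (hφ : ∀ τ u, φ τ (φ τ u) = u) (T : Finset ι) (D : ℕ)
    (hD : ∀ v, f v = false → (T.filter fun τ => f (φ τ v) ≠ f v).card ≤ D) :
    T.sum (fun τ => (univ.filter fun u : α => f u ≠ f (φ τ u)).card)
      ≤ 2 * D * (univ.filter fun v : α => f v = false).card := by
  classical
  set L : Finset α := univ.filter fun v : α => f v = false with hL
  -- per move: discordant inputs ≤ 2 · discordant losers
  have step1 : ∀ τ, (univ.filter fun u : α => f u ≠ f (φ τ u)).card
      ≤ 2 * (L.filter fun v => f v ≠ f (φ τ v)).card := by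
    intro τ
    have hsplit : (univ.filter fun u : α => f u ≠ f (φ τ u)).card
        = (L.filter fun v => f v ≠ f (φ τ v)).card
          + (univ.filter fun u : α => f u = true ∧ f u ≠ f (φ τ u)).card := by
      rw [hL, Finset.filter_filter, ← Finset.card_union_of_disjoint]
      · congr 1
        ext u
        simp only [Finset.mem_filter, Finset.mem_union, Finset.mem_univ, true_and]
        cases f u <;> simp
      · rw [Finset.disjoint_left]
        intro u h1 h2
        simp only [Finset.mem_filter, Finset.mem_univ, true_and] at h1 h2
        rw [h1.1] at h2
        exact Bool.false_ne_true h2.1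
    have hinj : (univ.filter fun u : α => f u = true ∧ f u ≠ f (φ τ u)).card
        ≤ (L.filter fun v => f v ≠ f (φ τ v)).card := by
      apply Finset.card_le_card_of_injOn (φ τ)
      · intro u hu
        simp only [Finset.coe_filter, Finset.mem_univ, true_and, Set.mem_setOf_eq] at hu
        simp only [hL, Finset.filter_filter, Finset.coe_filter, Finset.mem_univ, true_and, Set.mem_setOf_eq, hφ]
        obtain ⟨h1, h2⟩ := hu
        rw [h1] at h2
        refine ⟨?_, ?_⟩
        · cases h : f (φ τ u)
          · rfl
          · exact absurd h.symm h2
        · rw [h1]; exact fun h => h2 h.symm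
      · intro u _ v _ huv
        have := congrArg (φ τ) huv
        simpa [hφ] using this
    omega
  -- sum over moves and swap the order of summation
  have step2 : T.sum (fun τ => (L.filter fun v => f v ≠ f (φ τ v)).card) ≤ D * L.card := by
    have hswap : T.sum (fun τ => (L.filter fun v => f v ≠ f (φ τ v)).card)
        = L.sum (fun v => (T.filter fun τ => f v ≠ f (φ τ v)).card) := by
      simp only [Finset.card_filter]
      exact Finset.sum_comm
    rw [hswap]
    calc L.sum (fun v => (T.filter fun τ => f v ≠ f (φ τ v)).card)
        ≤ L.sum (fun _ => D) := by
          apply Finset.sum_le_sum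
          intro v hv
          have hv' : f v = false := by simpa [hL] using hv
          have := hD v hv'
          have heq : (T.filter fun τ => f v ≠ f (φ τ v)) = (T.filter fun τ => f (φ τ v) ≠ f v) := by
            apply Finset.filter_congr; intro τ _; exact ⟨fun h => fun h' => h h'.symm, fun h => fun h' => h h'.symm⟩
          rw [heq]; exact this
      _ = D * L.card := by rw [Finset.sum_const, smul_eq_mul, mul_comm]
  calc T.sum (fun τ => (univ.filter fun u : α => f u ≠ f (φ τ u)).card)
      ≤ T.sum (fun τ => 2 * (L.filter fun v => f v ≠ f (φ τ v)).card) :=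
        Finset.sum_le_sum fun τ _ => step1 τ
    _ = 2 * T.sum (fun τ => (L.filter fun v => f v ≠ f (φ τ v)).card) := by rw [Finset.mul_sum]
    _ ≤ 2 * (D * L.card) := Nat.mul_le_mul_left 2 step2
    _ = 2 * D * L.card := by ring


/-- Finset version of the double count: inputs range over a finite set `U` stable under every move. -/
theorem sum_discordant_le_on {α ι : Type*} [DecidableEq α] [DecidableEq ι]
    (f : α → Bool) (φ : ι → α → α) (hφ : ∀ τ u, φ τ (φ τ u) = u) (U : Finset α)
    (hU : ∀ τ u, u ∈ U → φ τ u ∈ U) (T : Finset ι) (D : ℕ)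
    (hD : ∀ v ∈ U, f v = false → (T.filter fun τ => f (φ τ v) ≠ f v).card ≤ D) :
    T.sum (fun τ => (U.filter fun u : α => f u ≠ f (φ τ u)).card)
      ≤ 2 * D * (U.filter fun v : α => f v = false).card := by
  classical
  set L : Finset α := U.filter fun v : α => f v = false with hL
  have step1 : ∀ τ, (U.filter fun u : α => f u ≠ f (φ τ u)).card
      ≤ 2 * (L.filter fun v => f v ≠ f (φ τ v)).card := by
    intro τ
    have hsplit : (U.filter fun u : α => f u ≠ f (φ τ u)).card
        = (L.filter fun v => f v ≠ f (φ τ v)).card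
          + (U.filter fun u : α => f u = true ∧ f u ≠ f (φ τ u)).card := by
      rw [hL, Finset.filter_filter, ← Finset.card_union_of_disjoint]
      · congr 1
        ext u
        simp only [Finset.mem_filter, Finset.mem_union]
        cases f u <;> simp
      · rw [Finset.disjoint_left]
        intro u h1 h2
        simp only [Finset.mem_filter] at h1 h2
        rw [h1.2.1] at h2
        exact Bool.false_ne_true h2.2.1
    have hinj : (U.filter fun u : α => f u = true ∧ f u ≠ f (φ τ u)).card
        ≤ (L.filter fun v => f v ≠ f (φ τ v)).card := by
      apply Finset.card_le_card_of_injOn (φ τ)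
      · intro u hu
        simp only [Finset.coe_filter, Set.mem_setOf_eq] at hu
        simp only [hL, Finset.filter_filter, Finset.coe_filter, Set.mem_setOf_eq, hφ]
        obtain ⟨hU', h1, h2⟩ := hu
        rw [h1] at h2
        refine ⟨hU τ u hU', ?_, ?_⟩
        · cases h : f (φ τ u)
          · rfl
          · exact absurd h.symm h2
        · rw [h1]; exact fun h => h2 h.symm
      · intro u _ v _ huv
        have := congrArg (φ τ) huv
        simpa [hφ] using this
    omega
  have step2 : T.sum (fun τ => (L.filter fun v => f v ≠ f (φ τ v)).card) ≤ D * L.card := by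
    have hswap : T.sum (fun τ => (L.filter fun v => f v ≠ f (φ τ v)).card)
        = L.sum (fun v => (T.filter fun τ => f v ≠ f (φ τ v)).card) := by
      simp only [Finset.card_filter]
      exact Finset.sum_comm
    rw [hswap]
    calc L.sum (fun v => (T.filter fun τ => f v ≠ f (φ τ v)).card)
        ≤ L.sum (fun _ => D) := by
          apply Finset.sum_le_sum
          intro v hv
          have hv' : v ∈ U ∧ f v = false := by simpa [hL] using hv
          have := hD v hv'.1 hv'.2
          have heq : (T.filter fun τ => f v ≠ f (φ τ v)) = (T.filter fun τ => f (φ τ v) ≠ f v) := by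
            apply Finset.filter_congr; intro τ _; exact ⟨fun h => fun h' => h h'.symm, fun h => fun h' => h h'.symm⟩
          rw [heq]; exact this
      _ = D * L.card := by rw [Finset.sum_const, smul_eq_mul, mul_comm]
  calc T.sum (fun τ => (U.filter fun u : α => f u ≠ f (φ τ u)).card)
      ≤ T.sum (fun τ => 2 * (L.filter fun v => f v ≠ f (φ τ v)).card) :=
        Finset.sum_le_sum fun τ _ => step1 τ
    _ = 2 * T.sum (fun τ => (L.filter fun v => f v ≠ f (φ τ v)).card) := by rw [Finset.mul_sum]
    _ ≤ 2 * (D * L.card) := Nat.mul_le_mul_left 2 step2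
    _ = 2 * D * L.card := by ring


/-- The SECOND-INVOLUTION count (R1-local plan v2): for an involution `ψ` of `U`, at least half of the `ψ`-discordant inputs of a
Boolean `f` have `f = true` (`ψ` pairs a discordant `false` with a discordant `true`). -/
theorem card_discordant_le_two_mul_card_true {α : Type*} [DecidableEq α]
    (f : α → Bool) (ψ : α → α) (hψ : ∀ u, ψ (ψ u) = u) (U : Finset α) (hU : ∀ u, u ∈ U → ψ u ∈ U) :
    (U.filter fun u => f u ≠ f (ψ u)).card ≤ 2 * (U.filter fun u => f u = true).card := by
  classical
  have hsplit : (U.filter fun u => f u ≠ f (ψ u)).card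
      = (U.filter fun u => f u = true ∧ f u ≠ f (ψ u)).card + (U.filter fun u => f u = false ∧ f u ≠ f (ψ u)).card := by
    rw [← Finset.card_union_of_disjoint]
    · congr 1
      ext u
      simp only [Finset.mem_filter, Finset.mem_union]
      cases f u <;> simp
    · rw [Finset.disjoint_left]
      intro u h1 h2
      simp only [Finset.mem_filter] at h1 h2
      rw [h1.2.1] at h2
      exact Bool.noConfusion h2.2.1
  have hinj : (U.filter fun u => f u = false ∧ f u ≠ f (ψ u)).card
      ≤ (U.filter fun u => f u = true ∧ f u ≠ f (ψ u)).card := by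
    apply Finset.card_le_card_of_injOn ψ
    · intro u hu
      simp only [Finset.coe_filter, Set.mem_setOf_eq] at hu ⊢
      obtain ⟨hU', h1, h2⟩ := hu
      rw [h1] at h2
      have h3 : f (ψ u) = true := by
        cases h : f (ψ u)
        · exact absurd h.symm h2
        · rfl
      refine ⟨hU u hU', h3, ?_⟩
      rw [hψ, h3, h1]
      exact fun h => Bool.noConfusion h
    · intro u _ v _ huv
      have := congrArg ψ huv
      simpa [hψ] using this
  have h1 : (U.filter fun u => f u = true ∧ f u ≠ f (ψ u)).card ≤ (U.filter fun u => f u = true).card := by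
    apply Finset.card_le_card
    intro u hu
    simp only [Finset.mem_filter] at hu ⊢
    exact ⟨hu.1, hu.2.1⟩
  omega

end Summit.QuantumAdvantage.AdviceFreeQNC0.LocalEngine

/-!
§2 Objects for two-step free-split strategies (ROUND-24 §1bis/§1ter) and the regime statements; §3 the composition
`walkHardFTwoStep_of : FarHeavy p → NearRegime p → WalkHardFTwoStep p` (kernel-checked; the regime lemmas are OPEN —
R1 `FarHeavy` = double count (§1, proved) + the local lemma `FarLocal` (stub, plan v2 = second involution);
R2' `NearRegime` (`#far < φ·n ⇒ win ≤ θ₂·|class|`) = the PINNED DICHOTOMY: pin the `≤ #far` far-split residues and the `2p` boundary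
bits, then per part either a free window + three lifts (`SparsePinned`, port of (G)) or block contraction with the block
non-degeneracy lemma (N1) (`DensePinned`).  The earlier two-sided statement `NearDense` (bias `≤ C·2ⁿ·δ^{#active}` whenever
`#far < η·#active`) is FALSE — conditional activation through a shared boundary split, see the docstring of `NearRegime` — and was
removed 2026-08-28; `Sparse3` (pin-free sparse branch) stays as a true sub-lemma.)
-/

namespace Summit.QuantumAdvantage.AdviceFreeQNC0.LocalEngine

open Finset Classical
open Summit.QuantumAdvantage.AdviceFreeQNC0.Coset21.RungG (classOf)

/-- explicit data of a two-step free-split strategy: cut `g` tests `α_g·#{i<s_g : u_i} + β_g·#{i≥s_g : u_i} ≡ r_g (mod p)`. -/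
structure TwoStep (p n : ℕ) where
  s : Fin (n + 1) → ℕ
  α : Fin (n + 1) → ZMod p
  β : Fin (n + 1) → ZMod p
  r : Fin (n + 1) → ZMod p

/-- the selection functions played by `S`. -/
def TwoStep.y {p n : ℕ} (S : TwoStep p n) : Fin (n + 1) → (Fin n → Bool) → Bool :=
  fun g u => decide ((univ.sum fun i : Fin n => if u i then (if i.val < S.s g then S.α g else S.β g) else 0) = S.r g)

/-- winning inputs of class `w` (endpoint weight mod `p`). -/
noncomputable def winIn {p n : ℕ} (c : ℕ) (S : TwoStep p n) (w : ZMod p) : Finset (Fin n → Bool) :=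
  (univ.filter fun u : Fin n → Bool => ringWinU c S.y u = true).filter fun u => ((wt u : ℕ) : ZMod p) = w

/-- cut `g` is FAR: interior position (`1 ≤ g < n`, so its phase reads the path at time `g`), genuinely two-valued form,
split at distance `≥ d₀` from the position and with room `p` on both sides (cuts at `g ∈ {0,n}` or with `s_g < p`,
`s_g > n-p` read ONE interior time once the `2p` boundary coordinates are pinned: they are NEAR for R2/R3). -/
def Far {p n : ℕ} (S : TwoStep p n) (d₀ : ℕ) (g : Fin (n + 1)) : Prop :=
  S.α g ≠ S.β g ∧ (1 ≤ g.val ∧ g.val < n) ∧ (g.val + d₀ ≤ S.s g ∨ S.s g + d₀ ≤ g.val) ∧ p ≤ S.s g ∧ S.s g + p ≤ n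

/-- cut `g` is ACTIVE in class `w`: it fires on some input of the class. -/
def Active {p n : ℕ} (S : TwoStep p n) (w : ZMod p) (g : Fin (n + 1)) : Prop :=
  ∃ u : Fin n → Bool, ((wt u : ℕ) : ZMod p) = w ∧ S.y g u = true

/-- Auxiliary `farCount` of the (G♯) local engine (planner qa-qnc0-p2 g24, `LocalEngine.lean`, verbatim; part 1). -/
noncomputable def farCount {p n : ℕ} (S : TwoStep p n) (d₀ : ℕ) : ℕ := (univ.filter fun g => Far S d₀ g).card

/-- Auxiliary `activeCount` of the (G♯) local engine (planner qa-qnc0-p2 g24, `LocalEngine.lean`, verbatim; part 1). -/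
noncomputable def activeCount {p n : ℕ} (S : TwoStep p n) (w : ZMod p) : ℕ := (univ.filter fun g => Active S w g).card

/-- number of cuts whose SPLIT sits at time `τ` (the co-observers of a corner flip at `τ`). -/
noncomputable def coSplit {p n : ℕ} (S : TwoStep p n) (τ : ℕ) : ℕ := (univ.filter fun g' : Fin (n + 1) => S.s g' = τ).card

/-- number of POPULAR positions: cuts `g` whose position is the split of more than `M` cuts (pigeonhole: `≤ (n+1)/(M+1)`). -/
noncomputable def popCount {p n : ℕ} (S : TwoStep p n) (M : ℕ) : ℕ :=
  (univ.filter fun g : Fin (n + 1) => M < coSplit S g.val).card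

/-- Auxiliary `popCount_mul_le` of the (G♯) local engine (planner qa-qnc0-p2 g24, `LocalEngine.lean`, verbatim; part 1). -/
theorem popCount_mul_le {p n : ℕ} (S : TwoStep p n) (M : ℕ) : popCount S M * (M + 1) ≤ n + 1 := by
  set Pop : Finset (Fin (n + 1)) := univ.filter fun g : Fin (n + 1) => M < coSplit S g.val with hPop
  have h1 : Pop.card * (M + 1) ≤ ∑ g ∈ Pop, coSplit S g.val := by
    rw [Finset.card_eq_sum_ones, Finset.sum_mul]
    apply Finset.sum_le_sum
    intro g hg
    rw [hPop, Finset.mem_filter] at hg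
    omega
  have hdisj : ∀ a ∈ Pop, ∀ b ∈ Pop, a ≠ b →
      Disjoint (univ.filter fun g' : Fin (n + 1) => S.s g' = a.val) (univ.filter fun g' : Fin (n + 1) => S.s g' = b.val) := by
    intro a _ b _ hab
    rw [Finset.disjoint_filter]
    intro g' _ ha hb
    exact hab (Fin.ext (ha ▸ hb))
  have h2 : ∑ g ∈ Pop, coSplit S g.val
      = (Pop.biUnion fun g => univ.filter fun g' : Fin (n + 1) => S.s g' = g.val).card := by
    rw [Finset.card_biUnion hdisj]
    rfl
  have h3 : (Pop.biUnion fun g => univ.filter fun g' : Fin (n + 1) => S.s g' = g.val).card ≤ n + 1 := by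
    have := Finset.card_le_univ (Pop.biUnion fun g => univ.filter fun g' : Fin (n + 1) => S.s g' = g.val)
    simpa [Fintype.card_fin] using this
  have h0 : popCount S M = Pop.card := by rw [hPop]; rfl
  rw [h0]
  omega

/-- the corner flip at time `τ`: swap coordinates `τ-1` and `τ` (identity if `τ = 0` or `τ ≥ n`); changes `|u_{<τ}|` only. -/
def cornerFlip (n τ : ℕ) (u : Fin n → Bool) : Fin n → Bool :=
  if h : 1 ≤ τ ∧ τ < n then u ∘ Equiv.swap (⟨τ - 1, by omega⟩ : Fin n) ⟨τ, h.2⟩ else u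

/-- Auxiliary `cornerFlip_cornerFlip` of the (G♯) local engine (planner qa-qnc0-p2 g24, `LocalEngine.lean`, verbatim; part 1). -/
theorem cornerFlip_cornerFlip (n τ : ℕ) (u : Fin n → Bool) : cornerFlip n τ (cornerFlip n τ u) = u := by
  unfold cornerFlip
  split_ifs with h
  · funext i
    simp only [Function.comp_apply, Equiv.swap_apply_self]
  · rfl

/-! ### The regime statements (stubs of the plan; all OPEN) -/

/-- **R1-local** (the one new ingredient): at the position `τ = g` of a FAR cut (co-observed as a split by at most `M` cuts — slack
that plan v2 below does not even use), a constant fraction `κ = κ(p, d₀) > 0` of the class is discordant under the corner flip at `τ`.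
PLAN v2 (second involution, ROUND-24 §1ter): on inputs with a corner at `τ`, `disc_τ = F·1_Λ ⊕ ⊕_j G_j·1_{Φ_j}` where `F = [N(s_g) ≡ a_g (p)]`
is cut `g`'s fire bit (remote), `Λ` = "cut `g`'s liveness flips" and `Φ_j` = "co-observer `j`'s fire bit flips" are LOCAL events
(functions of `N(τ) mod 3p` and the corner's direction), and `G_j = [N(t_j) ≢ c_j (3)]` is co-observer `j`'s liveness.  Partition the
class into cells by the local data at `τ` (window of radius `d₀/2`, `N(τ) mod 3p`, `W mod 3p`); on a cell with `corner_τ ∧ Λ`,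
`disc_τ = F ⊕ Z` with `Z` untouched by the corner flip `ψ` at the SPLIT `s_g` except through the (at most one) co-observer sitting at
position `s_g`; `ψ` preserves cells and the class, so by `card_discordant_le_two_mul_card_true` `#{disc_τ} ≥ ½·#{u : corner at s_g,
(N(s_g) mod 3p, dir) ∈ C'}` with `C' ⊂ ℤ_{3p} × {±}` NONEMPTY and containing a residue `≤ p − 1` (checked by hand for `p = 5`) — whatever
the number of co-observers.  Remaining analytic input: two equidistribution bounds of (G)-type (`P(corner_τ ∧ Λ) ≥ c`, and
`P(corner_{s_g} ∧ N(s_g) ≡ x₀ | cell) ≥ c(p, d₀)` using `p ≤ s_g ≤ n − p`, `|s_g − τ| ≥ d₀`; tools `RungG.stub_equidist`, `stub_contraction`). -/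
def FarLocal (p : ℕ) : Prop :=
  ∃ d₀ : ℕ, ∀ M : ℕ, ∃ κ : ℝ, 0 < κ ∧ ∃ n₀ : ℕ, ∀ n ≥ n₀,
    ∀ (c : ℕ) (S : TwoStep p n) (w : ZMod p) (g : Fin (n + 1)),
      Far S d₀ g → coSplit S g.val ≤ M →
        κ * ((classOf p w : Finset (Fin n → Bool)).card : ℝ)
          ≤ (((classOf p w : Finset (Fin n → Bool)).filter fun u =>
                ringWinU c S.y u ≠ ringWinU c S.y (cornerFlip n g.val u)).card : ℝ)

/-- **R1 (far-heavy)**: `losers · #active ≥ c₁ · (#far − #popular) · |class|` — from `FarLocal` by the double count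
`sum_discordant_le_on` (moves = corner flips at the unpopular far positions; a loser is discordant only at times observed by
active cuts, `≤ 2·#active` of them); `#popular ≤ (n+1)/(M+1)` by `popCount_mul_le`.  PROVED below: `farHeavy_of_farLocal`. -/
def FarHeavy (p : ℕ) : Prop :=
  ∃ d₀ : ℕ, ∀ M : ℕ, ∃ c₁ : ℝ, 0 < c₁ ∧ ∃ n₀ : ℕ, ∀ n ≥ n₀, ∀ (c : ℕ) (S : TwoStep p n) (w : ZMod p),
    c₁ * ((farCount S d₀ : ℝ) - (popCount S M : ℝ)) * ((classOf p w : Finset (Fin n → Bool)).card : ℝ)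
      ≤ (activeCount S w : ℝ) *
          (((classOf p w : Finset (Fin n → Bool)).card : ℝ) - ((winIn c S w).card : ℝ))

/-- **R2' (near regime)**: `o(n)` far cuts ⇒ a relative bound `θ₂ < 1` on every endpoint class (for `n ≥ n₀`).
REFUTED PREDECESSOR (2026-08-28): the two-sided `NearDense` ("`#far < η·#active ⇒ |win − cls/2| ≤ C·2ⁿ·δ^{#active}`") is false for
every `p`: take all `n+1` cuts with split `s_g = 1` and `r_g = (α_g − β_g) + β_g·w`, so that on the class `wt ≡ w (p)` cut `g` fires iff
`u₀ = 1`; then `#far = 0` (splits `< p` are not `Far`), every cut is active, on `u₀ = 0` nothing fires (lose) and on `u₀ = 1` the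
parity of `n+1` live bits is `½ ± o(1)`: `win ≈ cls/4`, bias `≈ cls/4 ≫ C·2ⁿ·δ^{n+1}`.  Firing ONE extra cut on `u₀ = 0` even gives
`win ≈ 7/12·cls > cls/2`, so no one-sided `½ + o(1)` survives either.  The mechanism (conditional activation through a shared early
split) disappears after PINNING: given the `2p` boundary bits and the residues `N(τ) mod p` at the `≤ #far` far-split times `τ`, EVERY
cut is a local observable of width `< d₀` (far / boundary-split cuts have constant fire bit, `α = β` cuts test the class only,
position-`0`/`n` cuts have constant live bit), and activity relative to a part `Q` is self-consistent under the three lifts.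
PLAN (pinned dichotomy, per part `Q` of the class): (sparse) `(2·act_Q + #pins + 1)·m ≤ n` ⇒ free window avoiding positions/splits
of `Q`-active cuts and all pins, lifts `r, r+p, r+2p` stay in `Q` ⇒ `win ∩ Q ≤ (2/3 + ε)|Q|` (`SparsePinned`, port of
`WalkFiniteStateRungSparse`); (dense) otherwise `≥ n/(4m)` cuts are effective on `Q` ⇒ `≥ n/(8m(L+1))` unpinned blocks of length `L`
contain an effective cut ⇒ `|bias on Q| ≤ 2ⁿ(1−κ)^{#good blocks}` by (G)'s operator bookkeeping (`sumSq_prodOp_le`) on the enlarged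
state `ℤ_{3p} × {0,1}^{d₀}` plus the BLOCK NON-DEGENERACY LEMMA (N1): a block whose cuts include an effective CENTRAL cut has status
parity not `(entry ⊔ exit)`-measurable (⇔ block operator norm `≤ 1 − κ(p,d₀,L)` once `L ≥ 3p − 1 + d₀`).  (N1) evidence: exhaustive
`F₂` search `line24/cancel4.py|cancel5.py` (p = 5): no cancelling family with a central cut for `(L,d₀) = (5,1), (6,2)`, `(7,2)` up to
5 other positions; `cancel.py`: the span of ALL status vectors in a window `L ≤ 6` meets the `W`-cell constants trivially (rank
`20L² + 5L + 65`).  (N1) conceptual proof = the same two involutions as `FarLocal` (corner flips at the central cut's position and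
split; the case `|s − g| = 1` needs care).  Summing parts costs `p^{#pins}·2^{2p}`, beaten by `(1−κ)^{n/(8m(L+1))}` for `φ ≤ φ₀(m,L,κ,p)`. -/
def NearRegime (p : ℕ) : Prop :=
  ∀ d₀ : ℕ, ∃ φ : ℝ, 0 < φ ∧ ∃ θ₂ : ℝ, θ₂ < 1 ∧ ∃ n₀ : ℕ, ∀ n ≥ n₀, ∀ (c : ℕ) (S : TwoStep p n) (w : ZMod p),
    (farCount S d₀ : ℝ) < φ * (n : ℝ) →
      ((winIn c S w).card : ℝ) ≤ θ₂ * ((classOf p w : Finset (Fin n → Bool)).card : ℝ)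

/-- **R3 (sparse, pin-free special case of the sparse branch of `NearRegime`; TRUE, not used by the composition any more)**:
few active cuts ⇒ relative bound `2/3 + ε` ((G)'s free window + three lifts; `2·#active` observed points). -/
def Sparse3 (p : ℕ) : Prop :=
  ∀ ε : ℝ, 0 < ε → ∃ m : ℕ, 0 < m ∧ ∀ (n c : ℕ) (S : TwoStep p n) (w : ZMod p),
    (2 * activeCount S w + 1) * m ≤ n →
      ((winIn c S w).card : ℝ) ≤ (2 / 3 + ε) * ((classOf p w : Finset (Fin n → Bool)).card : ℝ)

/-- the target, explicit-data form of (G♯) `WalkHardFTwoStepFree p`. -/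
def WalkHardFTwoStep (p : ℕ) : Prop :=
  ∃ θ : ℝ, θ < 1 ∧ ∃ n₀ : ℕ, ∀ n ≥ n₀, ∀ (c : ℕ) (S : TwoStep p n),
    ((univ.filter fun u : Fin n → Bool => ringWinU c S.y u = true).card : ℝ) ≤ θ * (2 : ℝ) ^ n


end Summit.QuantumAdvantage.AdviceFreeQNC0.LocalEngine
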